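import Literature.NumberTheory.EllipticCurves.Fisher2012.HessePencilThreeClosedForms
import Literature.NumberTheory.EllipticCurves.Fisher2012.DualHessePencilThreeLeftInverse
import Literature.NumberTheory.EllipticCurves.Fisher2012.DualHessePencilThreeLineIdentities
import Literature.NumberTheory.EllipticCurves.Fisher2012.ThreeTorsionLineTransfer
import HarnessLib

/-!
# DISCHARGE of `Fisher2012.thm132rev_threeCongruent_dualHessePencil` — Fisher, Proc. LMS 104
# (2012) §13, the `X_E^-(3)` analogue of Thm. 13.2, direction "if", `n = 3`, `K = ℚ`: every
# non-singular member `E^-_{λ,μ}` of the DUAL Hesse pencil of `E : y² = x³ − 27c₄x − 54c₆` has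
# `E^-_{λ,μ}[3] ≅ E[3]` as `Γ_ℚ`-modules
# (cell `b2b-bsdres`, team n1011, seat p02 gen 8 — 'T-F132-3R'; the named fact was registered by the
# class-closure lane in `HesseFamilyThreeReverse.lean` (registry A243) and is consumed by
# `threeCongruent_of_dualHesseCertificate` and `O5/X3ECertificates.torsionIso_of_x3eReverse`; this
# file proves it, so those consumers can drop `hF`)

HONEST FRAMING (cell `b2b-bsdres`, run/shared/lean/b2b/bsd-rank1-residual/, verbatim in every
file): the goal of the cell is to DELETE the COMBINATION-SHAPED residual classes of the
Birch–Swinnerton-Dyer formula for ALL analytic-rank `≤ 1` elliptic curves over `ℚ` — "full BSD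
formula for every rank `≤ 1` curve in class `C`" assembled STRICTLY from published theorems — so
that the rank-`≤ 1` remainder becomes exactly the CONSTRUCTION-SHAPED classes, which are TYPED
(missing-input `Prop`s), NOT attempted. This is not "finishing BSD". This file: our formalisation of
a published statement (NET named-fact debt −1); no definition, no new named fact; no label changes.
The registered statement is WEAKER than print (the Weil-pairing clause "reverse" is dropped): it asks
for an isomorphism of `Γ_ℚ`-MODULES, which is what we construct.

## Proof (the flex ↦ harmonic-polar correlation; files R1, R2a–c of this seat)

Write `E : y² = x³ + Ax + B`, `A = −27c₄`, `B = −54c₆`. A reverse `3`-congruence is not induced by a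
collineation of the plane of `E` (the Hessian group realises only symplectic automorphisms of
`E[3]`); it is induced by a CORRELATION: the flex `p = (x₀, y₀) ∈ E[3]` goes to its HARMONIC POLAR
`H_p = (3x₀² + A : 2y₀ : 3x₀³ + 5Ax₀ + 6B)`, a point of the dual plane `ℙ²*` (`H_O = (0:1:0)`; the
polar conic of a flex splits as tangent × harmonic polar, cofactor `12x₀y₀² − (3x₀²+A)² = Ψ₃(x₀)`).
The nine points `H_p` are the base points of the DUAL Hesse pencil `ξP₀ + ηQ₀`,
`P₀ = Au³ + 9Buv² − 6Av²w + 3uw²`, `Q₀ = −2Bu³ + Au²w + 2A²uv² + 9Bv²w − w³`, whose member at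
`(ξ, η) = (3(c₆l + c₄²m), c₄l + c₆m)` (Fisher's §9 substitution `λ = c₆ξ + c₄²η, μ = −c₄ξ − c₆η`
inverted) has the Weierstrass model `W₁ : y² = x³ − 𝔄x − 2𝔅` (files R2a–c) with
`⟨54(c₄³−c₆²), 0, 0, 0⟩ • W₁ = dualHessePencil3 c₄ c₆ l m` (this file: two polynomial identities
against the tree's closed forms `eval_hesseD3`, `eval_hesseC6three`).  Collinear flexes have
CONCURRENT harmonic polars (the three polars of the points of a `3`-torsion line `y = sx + t` pass
through the vertex `(−s² : s³ − t : 1)` of the flex triangle opposite that line), so after the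
Weierstrass normalisation of the dual plane the map `(x, y) ↦ (Ñ(x)/D(x), c·y/D(x))` carries torsion
lines to torsion lines (`dual3_line`); with `dual3_den_ne_zero`, `dual3_inj`, `dual3_eval_Ψ₃_eq_zero`,
`dual3_equation` it is a torsion-line transfer datum, and `threeCongruent_of_torsionLineDatum`
(file R1) turns it into a `Γ_ℚ`-equivariant additive bijection `E[3] ≃ W₁[3]`; composing with the
change of variables to `dualHessePencil3 c₄ c₆ l m` and inverting gives the statement.  As in the
direct case (file F4) the `ℚ`-algebra structure of `ℚ̄` is pinned to `AlgebraicClosure.instAlgebra ℚ`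
inside the proof (the tree has two instances).

References: [Fisher2012Hessian] T. Fisher, The Hessian of a genus one curve, Proc. LMS (3) 104 (2012)
613–648, §8, §9, Def. 13.1, Thm. 13.2 and the `X_E^-(n)` paragraph of §13; [SilvermanAEC2009] III.1,
III.2.3, Cor. III.6.4, Ex. 3.7.
-/

noncomputable section

open scoped Classical

open WeierstrassCurve Polynomial Literature.NumberTheory.EllipticCurves

namespace Literature.NumberTheory.EllipticCurves.Fisher2012

/-- The inverse of an equivariant additive isomorphism is equivariant. [folklore] -/
private theorem addEquiv_symm_smul_comm' {G M N : Type*} [SMul G M] [SMul G N] [AddCommGroup M]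
    [AddCommGroup N] (f : M ≃+ N) (hf : ∀ (σ : G) (P : M), f (σ • P) = σ • f P) (σ : G) (P : N) :
    f.symm (σ • P) = σ • f.symm P := by
  apply f.injective
  rw [f.apply_symm_apply, hf, f.apply_symm_apply]

/-- Discriminant of a short model: `Δ(y² = x³ + ax + b) = −16(4a³ + 27b²)`. [folklore] -/
private theorem Δ_shortModel (a b : ℚ) :
    (⟨0, 0, 0, a, b⟩ : WeierstrassCurve ℚ).Δ = -16 * (4 * a ^ 3 + 27 * b ^ 2) := by
  simp only [WeierstrassCurve.Δ, WeierstrassCurve.b₂, WeierstrassCurve.b₄, WeierstrassCurve.b₆,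
    WeierstrassCurve.b₈]
  ring

/-- Scaling lemma: `⟨u,0,0,0⟩ • (y² = x³ + a₄x + a₆) = (y² = x³ + a₄'x + a₆')` when `a₄ = u⁴a₄'`,
`a₆ = u⁶a₆'`. [cite: SilvermanAEC2009, III §1 (Table 3.1: u⁴a₄′ = a₄, u⁶a₆′ = a₆ when r = s = t = 0)] -/
private theorem smul_shortModel_eq (a₄ a₆ a₄' a₆' u : ℚ) (hu : u ≠ 0) (h4 : a₄ = u ^ 4 * a₄')
    (h6 : a₆ = u ^ 6 * a₆') :
    (⟨Units.mk0 u hu, 0, 0, 0⟩ : VariableChange ℚ) • (⟨0, 0, 0, a₄, a₆⟩ : WeierstrassCurve ℚ) =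
      ⟨0, 0, 0, a₄', a₆'⟩ := by
  have hui : ((Units.mk0 u hu)⁻¹ : ℚˣ) = (u⁻¹ : ℚ) := by
    rw [Units.val_inv_eq_inv_val, Units.val_mk0]
  ext
  · rw [variableChange_a₁]; simp
  · rw [variableChange_a₂]; simp
  · rw [variableChange_a₃]; simp
  · rw [variableChange_a₄, hui, h4]; field_simp; ring
  · rw [variableChange_a₆, hui, h6]; field_simp; ring

set_option maxRecDepth 8000 in
/-- **Fisher 2012, §13: the `X_E^-(3)` analogue of Theorem 13.2 (`n = 3`, direction "if", `K = ℚ`)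
— PROVED**: for every elliptic curve `E : y² = x³ − 27c₄x − 54c₆` over `ℚ` and every non-singular
member `E^-_{λ,μ}` (`λ, μ ∈ ℚ`) of its DUAL `n = 3` Hesse pencil there is a `Γ_ℚ`-equivariant
isomorphism `E^-_{λ,μ}[3] ≅ E[3]`.  Discharges the named fact
`thm132rev_threeCongruent_dualHessePencil` of `HesseFamilyThreeReverse.lean`.
[cite: Fisher2012Hessian, §13 (analogue of Thm. 13.2 for X_E^-(n), n = 3; with §9 and Def. 13.1)] -/
theorem thm132rev_threeCongruent_dualHessePencil_holds : thm132rev_threeCongruent_dualHessePencil := by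
  intro c₄ c₆ l m hE hE'
  -- pin the `ℚ`-algebra structure of `ℚ̄` to the one the generic transfer theorem carries
  letI : Algebra ℚ (AlgebraicClosure ℚ) := AlgebraicClosure.instAlgebra ℚ
  -- rational parameters `A, B, ξ, η`
  obtain ⟨A, hA⟩ : ∃ A : ℚ, A = -27 * c₄ := ⟨_, rfl⟩
  obtain ⟨B, hB⟩ : ∃ B : ℚ, B = -54 * c₆ := ⟨_, rfl⟩
  obtain ⟨ξ, hξ⟩ : ∃ ξ : ℚ, ξ = 3 * (c₆ * l + c₄ ^ 2 * m) := ⟨_, rfl⟩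
  obtain ⟨η, hη⟩ : ∃ η : ℚ, η = c₄ * l + c₆ * m := ⟨_, rfl⟩
  have hW0 : c4c6Model c₄ c₆ = ⟨0, 0, 0, A, B⟩ := by rw [hA, hB]; rfl
  have hΔ' : c₄ ^ 3 - c₆ ^ 2 ≠ 0 := by
    have h := (c4c6Model c₄ c₆).isUnit_Δ.ne_zero
    rw [Δ_c4c6Model] at h
    intro h0; apply h; rw [h0, mul_zero]
  have hΔ : 4 * A ^ 3 + 27 * B ^ 2 ≠ 0 := by
    have e : 4 * A ^ 3 + 27 * B ^ 2 = -78732 * (c₄ ^ 3 - c₆ ^ 2) := by rw [hA, hB]; ring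
    rw [e]; exact mul_ne_zero (by norm_num) hΔ'
  -- the member `W₁(ξ,η)` of the dual pencil and its scaling to Fisher's model
  obtain ⟨W₁, hW₁⟩ : ∃ W₁ : WeierstrassCurve ℚ, W₁ = ⟨0, 0, 0, -((4*A^(5 : ℕ)*η^(4 : ℕ) + 72*A^(4 : ℕ)*η^(2 : ℕ)*ξ^(2 : ℕ) - 144*A^(3 : ℕ)*B*η^(3 : ℕ)*ξ - 108*A^(3 : ℕ)*ξ^(4 : ℕ) + 135*A^(2 : ℕ)*B^(2 : ℕ)*η^(4 : ℕ) + 864*A^(2 : ℕ)*B*η*ξ^(3 : ℕ) - 1458*A*B^(2 : ℕ)*η^(2 : ℕ)*ξ^(2 : ℕ) + 972*B^(3 : ℕ)*η^(3 : ℕ)*ξ + 243*B^(2 : ℕ)*ξ^(4 : ℕ))), -2 * ((16*A^(7 : ℕ)*η^(5 : ℕ)*ξ - 20*A^(6 : ℕ)*B*η^(6 : ℕ) + 180*A^(5 : ℕ)*B*η^(4 : ℕ)*ξ^(2 : ℕ) + 432*A^(5 : ℕ)*η*ξ^(5 : ℕ) - 108*A^(4 : ℕ)*B^(2 : ℕ)*η^(5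 : ℕ)*ξ - 2700*A^(4 : ℕ)*B*η^(2 : ℕ)*ξ^(4 : ℕ) - 135*A^(3 : ℕ)*B^(3 : ℕ)*η^(6 : ℕ) + 7560*A^(3 : ℕ)*B^(2 : ℕ)*η^(3 : ℕ)*ξ^(3 : ℕ) + 972*A^(3 : ℕ)*B*ξ^(6 : ℕ) - 8505*A^(2 : ℕ)*B^(3 : ℕ)*η^(4 : ℕ)*ξ^(2 : ℕ) - 4860*A^(2 : ℕ)*B^(2 : ℕ)*η*ξ^(5 : ℕ) + 4374*A*B^(4 : ℕ)*η^(5 : ℕ)*ξ + 10935*A*B^(3 : ℕ)*η^(2 : ℕ)*ξ^(4 : ℕ) - 1458*B^(5 : ℕ)*η^(6 : ℕ) - 7290*B^(4 : ℕ)*η^(3 : ℕ)*ξ^(3 : ℕ) + 729*B^(3 : ℕ)*ξ^(6 : ℕ)))⟩ := ⟨_, rfl⟩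
  have hu : (54 * (c₄ ^ 3 - c₆ ^ 2)) ≠ 0 := mul_ne_zero (by norm_num) hΔ'
  have hC : (⟨Units.mk0 _ hu, 0, 0, 0⟩ : VariableChange ℚ) • W₁ = dualHessePencil3 c₄ c₆ l m := by
    rw [hW₁, dualHessePencil3, eval_hesseD3, eval_hesseC6three]
    apply smul_shortModel_eq
    · rw [hA, hB, hξ, hη]; field_simp; ring
    · rw [hA, hB, hξ, hη]; field_simp; ring
  haveI hW₁E : W₁.IsElliptic := by
    rw [← inv_smul_smul (⟨Units.mk0 _ hu, 0, 0, 0⟩ : VariableChange ℚ) W₁, hC]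
    infer_instance
  have hQ : ((A^(3 : ℕ)*η^(4 : ℕ) - 18*A^(2 : ℕ)*η^(2 : ℕ)*ξ^(2 : ℕ) + 54*A*B*η^(3 : ℕ)*ξ - 27*A*ξ^(4 : ℕ) - 27*B^(2 : ℕ)*η^(4 : ℕ) + 54*B*η*ξ^(3 : ℕ))) ≠ 0 := by
    intro hQ0
    have hd := W₁.isUnit_Δ.ne_zero
    rw [hW₁, Δ_shortModel, dual3_discr A B ξ η _ _ _ rfl rfl rfl, hQ0] at hd
    exact hd (by ring)
  -- the datum over `ℚ`
  obtain ⟨c, hc⟩ : ∃ c : ℚ, c = 4 * (4 * A ^ 3 + 27 * B ^ 2) * ((A^(3 : ℕ)*η^(4 : ℕ) - 18*A^(2 : ℕ)*η^(2 : ℕ)*ξ^(2 : ℕ) + 54*A*B*η^(3 : ℕ)*ξ - 27*A*ξ^(4 : ℕ) - 27*B^(2 : ℕ)*η^(4 : ℕ) + 54*B*η*ξ^(3 : ℕ))) := ⟨_, rfl⟩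
  have hc0 : c ≠ 0 := by rw [hc]; exact mul_ne_zero (mul_ne_zero (by norm_num) hΔ) hQ
  obtain ⟨n₃, hn₃⟩ : ∃ n₃ : ℚ, n₃ = 12*A^(4 : ℕ)*η^(3 : ℕ) - 108*A^(3 : ℕ)*η*ξ^(2 : ℕ) + 324*A^(2 : ℕ)*B*η^(2 : ℕ)*ξ - 81*A*B^(2 : ℕ)*η^(3 : ℕ) - 324*A*B*ξ^(3 : ℕ) + 729*B^(2 : ℕ)*η*ξ^(2 : ℕ) := ⟨_, rfl⟩
  obtain ⟨n₂, hn₂⟩ : ∃ n₂ : ℚ, n₂ = -36*A^(4 : ℕ)*η^(2 : ℕ)*ξ + 36*A^(3 : ℕ)*B*η^(3 : ℕ) - 108*A^(3 : ℕ)*ξ^(3 : ℕ) + 324*A^(2 : ℕ)*B*η*ξ^(2 : ℕ) - 729*A*B^(2 : ℕ)*η^(2 : ℕ)*ξ + 486*B^(3 : ℕ)*η^(3 : ℕ) - 243*B^(2 : ℕ)*ξ^(3 : ℕ) := ⟨_, rfl⟩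
  obtain ⟨n₁, hn₁⟩ : ∃ n₁ : ℚ, n₁ = 20*A^(5 : ℕ)*η^(3 : ℕ) - 180*A^(4 : ℕ)*η*ξ^(2 : ℕ) + 540*A^(3 : ℕ)*B*η^(2 : ℕ)*ξ - 135*A^(2 : ℕ)*B^(2 : ℕ)*η^(3 : ℕ) - 540*A^(2 : ℕ)*B*ξ^(3 : ℕ) + 1215*A*B^(2 : ℕ)*η*ξ^(2 : ℕ) := ⟨_, rfl⟩
  obtain ⟨n₀, hn₀⟩ : ∃ n₀ : ℚ, n₀ = -12*A^(5 : ℕ)*η^(2 : ℕ)*ξ + 36*A^(4 : ℕ)*B*η^(3 : ℕ) - 36*A^(4 : ℕ)*ξ^(3 : ℕ) - 108*A^(3 : ℕ)*B*η*ξ^(2 : ℕ) + 405*A^(2 : ℕ)*B^(2 : ℕ)*η^(2 : ℕ)*ξ - 729*A*B^(2 : ℕ)*ξ^(3 : ℕ) + 1458*B^(3 : ℕ)*η*ξ^(2 : ℕ) := ⟨_, rfl⟩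
  obtain ⟨d₃, hd₃⟩ : ∃ d₃ : ℚ, d₃ = -18*A*ξ + 27*B*η := ⟨_, rfl⟩
  obtain ⟨d₂, hd₂⟩ : ∃ d₂ : ℚ, d₂ = 6*A^(2 : ℕ)*η + 27*B*ξ := ⟨_, rfl⟩
  obtain ⟨d₁, hd₁⟩ : ∃ d₁ : ℚ, d₁ = -30*A^(2 : ℕ)*ξ + 45*A*B*η := ⟨_, rfl⟩
  obtain ⟨d₀, hd₀⟩ : ∃ d₀ : ℚ, d₀ = 2*A^(3 : ℕ)*η - 27*A*B*ξ + 54*B^(2 : ℕ)*η := ⟨_, rfl⟩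
  obtain ⟨N, hN⟩ : ∃ N : ℚ[X], N = C n₃ * X ^ 3 + C n₂ * X ^ 2 + C n₁ * X + C n₀ := ⟨_, rfl⟩
  obtain ⟨D, hD⟩ : ∃ D : ℚ[X], D = C d₃ * X ^ 3 + C d₂ * X ^ 2 + C d₁ * X + C d₀ := ⟨_, rfl⟩
  -- everything over `ℚ̄`
  obtain ⟨A', hA'⟩ : ∃ A' : AlgebraicClosure ℚ, algebraMap ℚ (AlgebraicClosure ℚ) A = A' := ⟨_, rfl⟩
  obtain ⟨B', hB'⟩ : ∃ B' : AlgebraicClosure ℚ, algebraMap ℚ (AlgebraicClosure ℚ) B = B' := ⟨_, rfl⟩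
  obtain ⟨ξ', hξ'⟩ : ∃ ξ' : AlgebraicClosure ℚ, algebraMap ℚ (AlgebraicClosure ℚ) ξ = ξ' := ⟨_, rfl⟩
  obtain ⟨η', hη'⟩ : ∃ η' : AlgebraicClosure ℚ, algebraMap ℚ (AlgebraicClosure ℚ) η = η' := ⟨_, rfl⟩
  have hV : (c4c6Model c₄ c₆).baseChange (AlgebraicClosure ℚ) = ⟨0, 0, 0, A', B'⟩ := by
    rw [hW0]
    simp only [WeierstrassCurve.baseChange, WeierstrassCurve.map, map_zero, hA', hB']
  have hV₁ : W₁.baseChange (AlgebraicClosure ℚ) = ⟨0, 0, 0, -((4*A'^(5 : ℕ)*η'^(4 : ℕ) + 72*A'^(4 : ℕ)*η'^(2 : ℕ)*ξ'^(2 : ℕ) - 144*A'^(3 : ℕ)*B'*η'^(3 : ℕ)*ξ' - 108*A'^(3 : ℕ)*ξ'^(4 : ℕ) + 135*A'^(2 : ℕ)*B'^(2 : ℕ)*η'^(4 : ℕ) + 864*A'^(2 : ℕ)*B'*η'*ξ'^(3 : ℕ) - 1458*A'*B'^(2 : ℕ)*η'^(2 : ℕ)*ξ'^(2 : ℕ)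 + 972*B'^(3 : ℕ)*η'^(3 : ℕ)*ξ' + 243*B'^(2 : ℕ)*ξ'^(4 : ℕ))), -2 * ((16*A'^(7 : ℕ)*η'^(5 : ℕ)*ξ' - 20*A'^(6 : ℕ)*B'*η'^(6 : ℕ) + 180*A'^(5 : ℕ)*B'*η'^(4 : ℕ)*ξ'^(2 : ℕ) + 432*A'^(5 : ℕ)*η'*ξ'^(5 : ℕ) - 108*A'^(4 : ℕ)*B'^(2 : ℕ)*η'^(5 : ℕ)*ξ' - 2700*A'^(4 : ℕ)*B'*η'^(2 : ℕ)*ξ'^(4 : ℕ) - 135*A'^(3 : ℕ)*B'^(3 : ℕ)*η'^(6 : ℕ) + 7560*A'^(3 : ℕ)*B'^(2 : ℕ)*η'^(3 : ℕ)*ξ'^(3 : ℕ) + 972*A'^(3 : ℕ)*B'*ξ'^(6 : ℕ) - 8505*A'^(2 : ℕ)*B'^(3 : ℕ)*η'^(4 : ℕ)*ξ'^(2 : ℕ) - 4860*A'^(2 : ℕ)*B'^(2 : ℕ)*η'*ξ'^(5 : ℕ) + 4374*A'*B'^(4 : ℕ)*η'^(5 : ℕ)*ξ' + 10935*A'*B'^(3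 : ℕ)*η'^(2 : ℕ)*ξ'^(4 : ℕ) - 1458*B'^(5 : ℕ)*η'^(6 : ℕ) - 7290*B'^(4 : ℕ)*η'^(3 : ℕ)*ξ'^(3 : ℕ) + 729*B'^(3 : ℕ)*ξ'^(6 : ℕ)))⟩ := by
    rw [hW₁]
    simp only [WeierstrassCurve.baseChange, WeierstrassCurve.map, map_zero, map_neg, map_add,
      map_sub, map_mul, map_pow, map_ofNat, hA', hB', hξ', hη']
  have hΔK : 4 * A' ^ 3 + 27 * B' ^ 2 ≠ 0 := by
    have h := (_root_.map_ne_zero (algebraMap ℚ (AlgebraicClosure ℚ))).mpr hΔ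
    simpa only [map_add, map_mul, map_pow, map_ofNat, hA', hB'] using h
  have hQK : ((A'^(3 : ℕ)*η'^(4 : ℕ) - 18*A'^(2 : ℕ)*η'^(2 : ℕ)*ξ'^(2 : ℕ) + 54*A'*B'*η'^(3 : ℕ)*ξ' - 27*A'*ξ'^(4 : ℕ) - 27*B'^(2 : ℕ)*η'^(4 : ℕ) + 54*B'*η'*ξ'^(3 : ℕ))) ≠ 0 := by
    have h := (_root_.map_ne_zero (algebraMap ℚ (AlgebraicClosure ℚ))).mpr hQ
    simpa only [map_add, map_sub, map_mul, map_pow, map_ofNat, hA', hB', hξ', hη'] using h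
  have hcK : algebraMap ℚ (AlgebraicClosure ℚ) c = 4 * (4 * A' ^ 3 + 27 * B' ^ 2) * ((A'^(3 : ℕ)*η'^(4 : ℕ) - 18*A'^(2 : ℕ)*η'^(2 : ℕ)*ξ'^(2 : ℕ) + 54*A'*B'*η'^(3 : ℕ)*ξ' - 27*A'*ξ'^(4 : ℕ) - 27*B'^(2 : ℕ)*η'^(4 : ℕ) + 54*B'*η'*ξ'^(3 : ℕ))) := by
    rw [hc]
    simp only [map_add, map_sub, map_mul, map_pow, map_ofNat, hA', hB', hξ', hη']
  have haevN : ∀ x : AlgebraicClosure ℚ, aeval x N = ((12*A'^(4 : ℕ)*η'^(3 : ℕ) - 108*A'^(3 : ℕ)*η'*ξ'^(2 : ℕ) + 324*A'^(2 : ℕ)*B'*η'^(2 : ℕ)*ξ' - 81*A'*B'^(2 : ℕ)*η'^(3 : ℕ) - 324*A'*B'*ξ'^(3 : ℕ) + 729*B'^(2 : ℕ)*η'*ξ'^(2 : ℕ)) * x ^ 3 + (-36*A'^(4 : ℕ)*η'^(2 : ℕ)*ξ' + 36*A'^(3 : ℕ)*B'*η'^(3 : ℕ) - 108*A'^(3 :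 ℕ)*ξ'^(3 : ℕ) + 324*A'^(2 : ℕ)*B'*η'*ξ'^(2 : ℕ) - 729*A'*B'^(2 : ℕ)*η'^(2 : ℕ)*ξ' + 486*B'^(3 : ℕ)*η'^(3 : ℕ) - 243*B'^(2 : ℕ)*ξ'^(3 : ℕ)) * x ^ 2 + (20*A'^(5 : ℕ)*η'^(3 : ℕ) - 180*A'^(4 : ℕ)*η'*ξ'^(2 : ℕ) + 540*A'^(3 : ℕ)*B'*η'^(2 : ℕ)*ξ' - 135*A'^(2 : ℕ)*B'^(2 : ℕ)*η'^(3 : ℕ) - 540*A'^(2 : ℕ)*B'*ξ'^(3 : ℕ) + 1215*A'*B'^(2 : ℕ)*η'*ξ'^(2 : ℕ)) * x + (-12*A'^(5 : ℕ)*η'^(2 : ℕ)*ξ' + 36*A'^(4 : ℕ)*B'*η'^(3 : ℕ) - 36*A'^(4 : ℕ)*ξ'^(3 : ℕ) - 108*A'^(3 : ℕ)*B'*η'*ξ'^(2 : ℕ) + 405*A'^(2 : ℕ)*B'^(2 : ℕ)*η'^(2 : ℕ)*ξ' - 729*A'*B'^(2 : ℕ)*ξ'^(3 : ℕ) + 1458*B'^(3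 : ℕ)*η'*ξ'^(2 : ℕ))) := by
    intro x
    rw [hN, hn₃, hn₂, hn₁, hn₀]
    simp only [map_add, map_mul, map_pow, aeval_C, aeval_X, map_sub, map_neg, map_ofNat,
      hA', hB', hξ', hη']
  have haevD : ∀ x : AlgebraicClosure ℚ, aeval x D = ((-18*A'*ξ' + 27*B'*η') * x ^ 3 + (6*A'^(2 : ℕ)*η' + 27*B'*ξ') * x ^ 2 + (-30*A'^(2 : ℕ)*ξ' + 45*A'*B'*η') * x + (2*A'^(3 : ℕ)*η' - 27*A'*B'*ξ' + 54*B'^(2 : ℕ)*η')) := by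
    intro x
    rw [hD, hd₃, hd₂, hd₁, hd₀]
    simp only [map_add, map_mul, map_pow, aeval_C, aeval_X, map_sub, map_neg, map_ofNat,
      hA', hB', hξ', hη']
  have h01 : (c4c6Model c₄ c₆).a₁ = 0 := rfl
  have h02 : (c4c6Model c₄ c₆).a₂ = 0 := rfl
  have h03 : (c4c6Model c₄ c₆).a₃ = 0 := rfl
  have h11 : W₁.a₁ = 0 := by rw [hW₁]
  have h13 : W₁.a₃ = 0 := by rw [hW₁]
  obtain ⟨f, hf⟩ := threeCongruent_of_torsionLineDatum (K := ℚ) (c4c6Model c₄ c₆) W₁ h01 h02 h03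
    h11 h13 N D c hc0
    (by
      intro x hx
      rw [hV] at hx
      rw [haevD]
      exact dual3_den_ne_zero A' B' ξ' η' hΔK hQK hx)
    (by
      intro x₁ x₂ hx₁ hx₂ h
      rw [hV] at hx₁ hx₂
      rw [haevN, haevD, haevN, haevD] at h
      exact dual3_inj A' B' ξ' η' hΔK hQK hx₁ hx₂ h)
    (by
      intro x hx
      rw [hV] at hx
      rw [hV₁, haevN, haevD]
      exact dual3_eval_Ψ₃_eq_zero A' B' ξ' η' hΔK hQK hx)
    (by
      intro x y hxy hx
      rw [hV] at hxy hx
      rw [hV₁, haevN, haevD, hcK]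
      exact dual3_equation A' B' ξ' η' hΔK hQK hxy hx)
    (by
      intro s t hL1 hL2
      rw [hV] at hL1 hL2
      have hL1' : s ^ 4 + 2 * s * t + A' = 0 := hL1
      have hL2' : 2 * s ^ 3 * t + t ^ 2 - A' * s ^ 2 + 3 * B' = 0 := hL2
      obtain ⟨s', t', h⟩ := dual3_line A' B' ξ' η' hΔK s t hL1' hL2'
      refine ⟨s', t', fun x hx hq => ?_⟩
      rw [hV] at hx hq
      rw [haevN, haevD, hcK]
      exact h x hx hq)
  -- `f : E[3] ≃ W₁[3]`; compose with `W₁[3] ≃ (dualHessePencil3 c₄ c₆ l m)[3]` and invert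
  have h₂ := W₁.exists_geomTorsion_addEquiv_smul (⟨Units.mk0 _ hu, 0, 0, 0⟩ : VariableChange ℚ) 3
  rw [hC] at h₂
  obtain ⟨e₂, he₂⟩ := h₂
  refine ⟨(f.trans e₂).symm, addEquiv_symm_smul_comm' (f.trans e₂) (fun σ P => ?_)⟩
  simp only [AddEquiv.trans_apply, hf, he₂]

/-- **Unconditional `3`-torsion transport along the DUAL Hesse pencil, any model.** For every
elliptic curve `W/ℚ` and every non-singular member of the dual `n = 3` Hesse pencil of its
`c₄,c₆`-model, `E^-_{λ,μ}[3] ≅ W[3]` as `Γ_ℚ`-modules — the tree's `threeCongruent_dualHessePencil3`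
with its `hF` discharged. [cite: Fisher2012Hessian, §13 (analogue of Thm. 13.2 for X_E^-(3))] -/
theorem threeCongruent_dualHessePencil3_unconditional (W : WeierstrassCurve ℚ) [W.IsElliptic]
    (l m : ℚ) [(dualHessePencil3 W.c₄ W.c₆ l m).IsElliptic] :
    ∃ e : geomTorsion (dualHessePencil3 W.c₄ W.c₆ l m) (3 : ℤ) ≃+ geomTorsion W (3 : ℤ),
      ∀ (σ : Field.absoluteGaloisGroup ℚ) (Q : geomTorsion (dualHessePencil3 W.c₄ W.c₆ l m) (3 : ℤ)),
        e (σ • Q) = σ • e Q :=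
  threeCongruent_dualHessePencil3 thm132rev_threeCongruent_dualHessePencil_holds W l m

/-- **Unconditional dual-Hesse certificate, reverse kind.** `W, G` elliptic curves over `ℚ`,
`Δ′ = c₄(W)³ − c₆(W)²`, `l m u : ℚ`, `u ≠ 0`, with `−𝔇(l,m)/(4Δ′) = u⁴·c₄(G)` and
`−𝔠₆(l,m)/(8Δ′²) = u⁶·c₆(G)` ⟹ `G[3] ≅ W[3]` as `Γ_ℚ`-modules — the tree's
`threeCongruent_of_dualHesseCertificate` with its named-fact hypothesis `hF` DISCHARGED by
`thm132rev_threeCongruent_dualHessePencil_holds` (every REVERSE `X3E` Hesse certificate of the cell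
is now an unconditional kernel statement). [cite: Fisher2012Hessian, §13 (analogue of Thm. 13.2 for X_E^-(3))] -/
theorem threeCongruent_of_dualHesseCertificate_unconditional (W G : WeierstrassCurve ℚ) [W.IsElliptic]
    [G.IsElliptic] (l m u : ℚ) (hu : u ≠ 0)
    (h4 : -MvPolynomial.eval ![l, m] (hesseD3 W.c₄ W.c₆) / (4 * (W.c₄ ^ 3 - W.c₆ ^ 2)) = u ^ 4 * G.c₄)
    (h6 : -MvPolynomial.eval ![l, m] (hesseC6three W.c₄ W.c₆) / (8 * (W.c₄ ^ 3 - W.c₆ ^ 2) ^ 2) =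
      u ^ 6 * G.c₆) :
    ∃ e : geomTorsion G (3 : ℤ) ≃+ geomTorsion W (3 : ℤ),
      ∀ (σ : Field.absoluteGaloisGroup ℚ) (Q : geomTorsion G (3 : ℤ)), e (σ • Q) = σ • e Q :=
  threeCongruent_of_dualHesseCertificate thm132rev_threeCongruent_dualHessePencil_holds W G l m u hu h4 h6

end Literature.NumberTheory.EllipticCurves.Fisher2012

end
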